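import Mathlib
import Literature.Analysis.FluidPDE.CheskidovFriedlander2009.VanishingViscosityLimit
import Literature.Barriers.NavierStokesRegularity.DyadicCascadeBlowupProofs
import HarnessLib

/-!
# Cheskidov–Friedlander 2009, Thm. 3.2 (existence, positivity) via the tree's Cheskidov 2008 theory:
# the dictionary between the two normalisations of the forced viscous dyadic model

Cheskidov–Friedlander, Physica D 238 (2009) 783–787 = arXiv:0810.3718v1, Thm. 3.2 p. 7 ("For
every `a⁰ ∈ l²` with `a⁰_j ≥ 0` there exists a solution of (3.1) with `a(0) = a⁰`. Moreover,
`a_j(t) ≥ 0` for all `t > 0`") is quoted there from Cheskidov's well-posedness theory of the model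
(Cheskidov, Trans. AMS 360 (2008) 5101–5120, §4). That theory is PROVED in the tree, in
Cheskidov's normalisation `uₙ' + νλ^{2αn}uₙ − λⁿu²ₙ₋₁ + λ^{n+1}uₙuₙ₊₁ = gₙ`, `n ≥ 1`, `u₀ ≡ 0`
(`Literature.Barriers.NavierStokesRegularity.Dyadic.IsCheskidovSolution`,
`Cheskidov2008_thm44_holds` — global strong solutions for `α ≥ 1/2` and data in `V = H^α`;
`nonneg_of_isCheskidovSolution` — Thm. 4.2, positivity). This PROOF file supplies the exact
dictionary between the two normalisations and transports those theorems to the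
Cheskidov–Friedlander variables of `VanishingViscosityLimit.lean` (`rhs`, `IsSolution`, model
(1.2): `ȧ_j + ν2^{2j}a_j − 2^{c(j−1)}a²_{j−1} + 2^{cj}a_ja_{j+1} = f_j`, `j ≥ 0`):

  `λ = 2^c`, `α = 1/c` (so `λ^{2αn} = 2^{2n}`), `ν_Ch = ν/4`, `uₙ(t) = (2^c)^{−2} a_{n−1}(t)`
  (`n ≥ 1`), `u₀ ≡ 0`, `gₙ = (2^c)^{−2} f_{n−1}`;

a direct computation (the index shift costs the factor `λ² = 2^{2c}` in the quadratic terms and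
`2² = 4` in the viscous one). Consequences proved here:

* `IsSolution.isCheskidovSolution` / `IsSolution.of_isCheskidovSolution` — the two directions
  of the dictionary (any `c ≠ 0`, any `ν`, any force);
* `IsSolution.nonneg` — the positivity clause of Thm. 3.2 for EVERY solution with non-negative
  datum and `f₀ ≥ 0` (any `c ≠ 0`, any `ν`), from Cheskidov's Thm. 4.2;
* `exists_isSolution` — the existence clause of Thm. 3.2 in the range the tree's theorem covers:
  `0 < c ≤ 2` (`α = 1/c ≥ 1/2`), `ν > 0`, `f₀ ≥ 0`, and data of finite `H¹` norm
  (`h1NormSq a₀ < ⊤`; Cheskidov's `V = H^α` is exactly `Σ_j 2^{2(j+1)}a_j² < ∞` under the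
  dictionary) — NARROWER than the printed `a⁰ ∈ l²` and than the printed range `c ∈ (3/2, 5/2]`
  on the side `c > 2`; recorded, not hidden: the general `ℓ²`/`c ≤ 5/2` existence statement is
  Cheskidov's theory of evolutionary systems and is not in the tree;
* `exists_solutionFamily` — hence the hypothesis class of the named facts
  `CheskidovFriedlander2009_globalAttractor`/`_thm42` is inhabited for `c ∈ (3/2, 2]`: for every `ν > 0` a
  solution from any fixed non-negative `H¹` datum — and `CheskidovFriedlander2009_thm42.exists_floor`,
  the zeroth-law shape (a `ν`-uniform floor under the long-time mean dissipation of an explicit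
  class of vanishing-viscosity families) modulo the single named fact `…_thm42`.

No new definitions, no new facts.
-/

noncomputable section

open Filter Set MeasureTheory
open scoped Topology ENNReal BigOperators

namespace Literature.Analysis.FluidPDE.CheskidovFriedlander2009

open Literature.Barriers.NavierStokesRegularity.Dyadic

/-! ### The dictionary -/

/-- The viscous weights agree: `(2^c)^{2(1/c)n} = 2^{2n}` (`c ≠ 0`).
[cite: CheskidovFriedlander2009, §1 (1.2) p.2] -/
theorem two_rpow_rpow_weight {c : ℝ} (hc : c ≠ 0) (n : ℕ) :
    ((2 : ℝ) ^ c) ^ (2 * (1 / c) * (n : ℝ)) = (2 : ℝ) ^ (2 * n) := by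
  rw [← Real.rpow_mul (by norm_num : (0 : ℝ) ≤ 2)]
  have h : c * (2 * (1 / c) * (n : ℝ)) = ((2 * n : ℕ) : ℝ) := by
    push_cast
    field_simp
  rw [h, Real.rpow_natCast]

/-- Cheskidov's right-hand side with `λ = 2^c`, `α = 1/c` (`c ≠ 0`) in polynomial form: the
viscous weight `λ^{2αn}` is `2^{2n}`. [cite: Cheskidov2008, §3 (3.1)] -/
theorem cheskidovRHS_two_rpow {c : ℝ} (hc : c ≠ 0) (ν' : ℝ) (g u : ℕ → ℝ) (n : ℕ) :
    cheskidovRHS ((2 : ℝ) ^ c) ν' (1 / c) g u n =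
      -ν' * (2 : ℝ) ^ (2 * n) * u n + ((2 : ℝ) ^ c) ^ n * u (n - 1) ^ 2
        - ((2 : ℝ) ^ c) ^ (n + 1) * u n * u (n + 1) + g n := by
  unfold cheskidovRHS
  rw [two_rpow_rpow_weight hc n]

/-- Cheskidov's right-hand side at mode `n + 1`, evaluated on the shifted and rescaled sequence
`uₙ = (2^c)^{−2}x_{n−1}` (`u₀ = 0`) with force `gₙ₊₁ = (2^c)^{−2}f_n` and viscosity `ν/4`, is
`(2^c)^{−2}` times the Cheskidov–Friedlander right-hand side at mode `n`.
[cite: CheskidovFriedlander2009, §1 (1.2) p.2] [cite: Cheskidov2008, §3 (3.1)] -/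
theorem cheskidovRHS_shift {c : ℝ} (hc : c ≠ 0) (ν : ℝ) (f g x u : ℕ → ℝ)
    (hg : ∀ n, g (n + 1) = (((2 : ℝ) ^ c) ^ 2)⁻¹ * f n) (hu0 : u 0 = 0)
    (hu : ∀ n, u (n + 1) = (((2 : ℝ) ^ c) ^ 2)⁻¹ * x n) (n : ℕ) :
    cheskidovRHS ((2 : ℝ) ^ c) (ν / 4) (1 / c) g u (n + 1) =
      (((2 : ℝ) ^ c) ^ 2)⁻¹ * rhs c ν f x n := by
  have hL : (0 : ℝ) < (2 : ℝ) ^ c := Real.rpow_pos_of_pos two_pos c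
  rw [cheskidovRHS_two_rpow hc, Nat.add_sub_cancel, hg n, hu (n + 1)]
  cases n with
  | zero =>
    simp only [rhs, hu0, hu 0, Nat.zero_add]
    field_simp
    ring
  | succ m =>
    simp only [rhs, hu m, hu (m + 1), show m + 1 + 1 = m + 2 from rfl]
    field_simp
    ring

/-- **CF → Cheskidov.** A solution of the Cheskidov–Friedlander system (any `c ≠ 0`, `ν`, `f`)
yields, after the shift-and-rescale `uₙ = (2^c)^{−2}a_{n−1}`, `u₀ ≡ 0`, a solution of
Cheskidov's system (3.1) with `λ = 2^c`, `α = 1/c`, viscosity `ν/4` and force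
`gₙ = (2^c)^{−2}f_{n−1}` (`g₀ = 0`). [cite: CheskidovFriedlander2009, Def 3.1 p.7]
[cite: Cheskidov2008, §3 Def. 3.1] -/
theorem IsSolution.isCheskidovSolution {c ν : ℝ} {f : ℕ → ℝ} {a : ℕ → ℝ → ℝ} (hc : c ≠ 0)
    (ha : IsSolution c ν f a) :
    IsCheskidovSolution ((2 : ℝ) ^ c) (ν / 4) (1 / c)
      (fun n => match n with | 0 => 0 | m + 1 => (((2 : ℝ) ^ c) ^ 2)⁻¹ * f m)
      (fun n => match n with | 0 => 0 | m + 1 => (((2 : ℝ) ^ c) ^ 2)⁻¹ * a m 0)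
      (fun n t => match n with | 0 => 0 | m + 1 => (((2 : ℝ) ^ c) ^ 2)⁻¹ * a m t) := by
  refine ⟨fun _ => rfl, ?_, ?_, ?_⟩
  · intro n hn
    obtain ⟨m, rfl⟩ := Nat.exists_eq_add_of_le' hn
    rfl
  · intro n hn t ht
    obtain ⟨m, rfl⟩ := Nat.exists_eq_add_of_le' hn
    have hd := (ha.hasDerivWithinAt m t ht).const_mul ((((2 : ℝ) ^ c) ^ 2)⁻¹)
    rw [← cheskidovRHS_shift hc ν f
      (fun n => match n with | 0 => 0 | m + 1 => (((2 : ℝ) ^ c) ^ 2)⁻¹ * f m)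
      (fun i => a i t)
      (fun n => match n with | 0 => 0 | m + 1 => (((2 : ℝ) ^ c) ^ 2)⁻¹ * a m t)
      (fun _ => rfl) rfl (fun _ => rfl) m] at hd
    exact hd
  · intro t ht
    have hs : Summable fun m => ((((2 : ℝ) ^ c) ^ 2)⁻¹ * a m t) ^ 2 := by
      simpa only [mul_pow] using (ha.summable_sq t ht).mul_left (((((2 : ℝ) ^ c) ^ 2)⁻¹) ^ 2)
    exact (summable_nat_add_iff 1).mp hs

/-- **Cheskidov → CF.** A solution of Cheskidov's system with `λ = 2^c`, `α = 1/c` (`c ≠ 0`),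
viscosity `ν/4` and a force with `gₙ₊₁ = (2^c)^{−2}f_n` yields, after `a_j = (2^c)²u_{j+1}`, a
solution of the Cheskidov–Friedlander system with exponent `c`, viscosity `ν` and force `f`.
[cite: CheskidovFriedlander2009, Def 3.1 p.7] [cite: Cheskidov2008, §3 Def. 3.1] -/
theorem IsSolution.of_isCheskidovSolution {c ν : ℝ} {f : ℕ → ℝ} (hc : c ≠ 0) {g u0 : ℕ → ℝ}
    {u : ℕ → ℝ → ℝ} (hu : IsCheskidovSolution ((2 : ℝ) ^ c) (ν / 4) (1 / c) g u0 u)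
    (hg : ∀ n, g (n + 1) = (((2 : ℝ) ^ c) ^ 2)⁻¹ * f n) :
    IsSolution c ν f (fun j t => ((2 : ℝ) ^ c) ^ 2 * u (j + 1) t) where
  hasDerivWithinAt j t ht := by
    obtain ⟨h0, -, hder, -⟩ := hu
    have hL : (0 : ℝ) < (2 : ℝ) ^ c := Real.rpow_pos_of_pos two_pos c
    have hK : (((2 : ℝ) ^ c) ^ 2) ≠ 0 := by positivity
    have hd := (hder (j + 1) (by omega) t ht).const_mul (((2 : ℝ) ^ c) ^ 2)
    have hshift := cheskidovRHS_shift hc ν f g (fun i => ((2 : ℝ) ^ c) ^ 2 * u (i + 1) t)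
      (fun m => u m t) hg (h0 t) (fun n => by field_simp) j
    rw [hshift, ← mul_assoc, mul_inv_cancel₀ hK, one_mul] at hd
    exact hd
  summable_sq t ht := by
    obtain ⟨-, -, -, hsum⟩ := hu
    have hs : Summable fun j => u (j + 1) t ^ 2 := (summable_nat_add_iff 1).mpr (hsum t ht)
    simpa only [mul_pow] using hs.mul_left ((((2 : ℝ) ^ c) ^ 2) ^ 2)

/-! ### Positivity and existence (Thm. 3.2) -/

/-- **Positivity** (the "moreover" of Cheskidov–Friedlander Thm. 3.2, here for every solution):
for `c ≠ 0`, any viscosity `ν`, force `f₀ ≥ 0` on the first shell, a solution whose datum is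
non-negative stays non-negative for all `t ≥ 0`. Transported from Cheskidov's Thm. 4.2
(`nonneg_of_isCheskidovSolution`). [cite: CheskidovFriedlander2009, Thm 3.2 p.7]
[cite: Cheskidov2008, §4 Thm. 4.2] -/
theorem IsSolution.nonneg {c ν f₀ : ℝ} (hc : c ≠ 0) (hf : 0 ≤ f₀) {a : ℕ → ℝ → ℝ}
    (ha : IsSolution c ν (force f₀) a) (h0 : ∀ j, 0 ≤ a j 0) (j : ℕ) (t : ℝ) (ht : 0 ≤ t) :
    0 ≤ a j t := by
  have hL : (0 : ℝ) < (2 : ℝ) ^ c := Real.rpow_pos_of_pos two_pos c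
  have hKi : 0 ≤ (((2 : ℝ) ^ c) ^ 2)⁻¹ := by positivity
  have hu := ha.isCheskidovSolution hc
  have hg : ∀ n, 1 ≤ n →
      0 ≤ (fun n => match n with | 0 => 0 | m + 1 => (((2 : ℝ) ^ c) ^ 2)⁻¹ * force f₀ m) n := by
    intro n hn
    obtain ⟨m, rfl⟩ := Nat.exists_eq_add_of_le' hn
    cases m with
    | zero => simpa [force_zero] using mul_nonneg hKi hf
    | succ m => simp [force_succ]
  have hu0 : ∀ n, 1 ≤ n →
      0 ≤ (fun n => match n with | 0 => 0 | m + 1 => (((2 : ℝ) ^ c) ^ 2)⁻¹ * a m 0) n := by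
    intro n hn
    obtain ⟨m, rfl⟩ := Nat.exists_eq_add_of_le' hn
    exact mul_nonneg hKi (h0 m)
  have hpos := nonneg_of_isCheskidovSolution hL.le hg hu0 hu (j + 1) t ht
  -- `u_{j+1}(t) = (2^c)^{−2} a_j(t) ≥ 0`
  have hrepr : (((2 : ℝ) ^ c) ^ 2)⁻¹ * a j t ≥ 0 := hpos
  by_contra hneg
  push Not at hneg
  have : (((2 : ℝ) ^ c) ^ 2)⁻¹ * a j t < 0 := mul_neg_of_pos_of_neg (by positivity) hneg
  linarith

/-- Under the dictionary, Cheskidov's space `V = H^α` (`Σ_{n≥1} λ^{2αn}uₙ² < ∞`) is the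
Cheskidov–Friedlander space `H¹` (`Σ_j 2^{2j}a_j² < ∞`): the weighted norm of the shifted,
rescaled datum is `4(2^c)^{−4}` times `‖a₀‖²_{H¹}`. [cite: CheskidovFriedlander2009, §1 p.3]
[cite: Cheskidov2008, §3] -/
theorem dyadicNormSq_shift {c : ℝ} (hc : c ≠ 0) (a₀ : ℕ → ℝ) :
    dyadicNormSq ((2 : ℝ) ^ c) (1 / c)
        (fun n => match n with | 0 => 0 | m + 1 => (((2 : ℝ) ^ c) ^ 2)⁻¹ * a₀ m) =
      ENNReal.ofReal (4 * ((((2 : ℝ) ^ c) ^ 2)⁻¹) ^ 2) * h1NormSq a₀ := by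
  rw [dyadicNormSq_eq_tsum_succ, h1NormSq, ← ENNReal.tsum_mul_left]
  refine tsum_congr fun m => ?_
  have hw := two_rpow_rpow_weight hc (m + 1)
  push_cast at hw ⊢
  rw [hw, ← ENNReal.ofReal_mul (by positivity)]
  congr 1
  ring

/-- **Existence** (the existence clause of Cheskidov–Friedlander Thm. 3.2, in the range covered by
the tree's proof of Cheskidov 2008 Thm. 4.4): for `0 < c ≤ 2`, `ν > 0`, `f₀ ≥ 0` and every datum
of finite `H¹` norm there is a solution of (1.2) on `[0,∞)` from that datum. (Printed: all
`a⁰ ∈ l²`, `c ∈ (3/2, 5/2]`; the side `2 < c ≤ 5/2` and rough `ℓ²` data are NOT covered here.)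
[cite: CheskidovFriedlander2009, Thm 3.2 p.7] [cite: Cheskidov2008, §4 Thm. 4.4] -/
theorem exists_isSolution {c ν f₀ : ℝ} (hc : 0 < c) (hc2 : c ≤ 2) (hν : 0 < ν) (hf : 0 ≤ f₀)
    {a₀ : ℕ → ℝ} (ha₀ : h1NormSq a₀ < ⊤) :
    ∃ a : ℕ → ℝ → ℝ, IsSolution c ν (force f₀) a ∧ ∀ j, a j 0 = a₀ j := by
  have hL : (1 : ℝ) < (2 : ℝ) ^ c := Real.one_lt_rpow (by norm_num) hc
  have hL0 : (0 : ℝ) < (2 : ℝ) ^ c := by linarith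
  have hK : (((2 : ℝ) ^ c) ^ 2) ≠ 0 := by positivity
  have hα : 1 / 2 ≤ 1 / c := one_div_le_one_div_of_le hc hc2
  set g : ℕ → ℝ := fun n => match n with | 0 => 0 | m + 1 => (((2 : ℝ) ^ c) ^ 2)⁻¹ * force f₀ m
    with hg_def
  set u0 : ℕ → ℝ := fun n => match n with | 0 => 0 | m + 1 => (((2 : ℝ) ^ c) ^ 2)⁻¹ * a₀ m
    with hu0_def
  have hg : ∀ n, 1 ≤ n → 0 ≤ g n := by
    intro n hn
    obtain ⟨m, rfl⟩ := Nat.exists_eq_add_of_le' hn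
    cases m with
    | zero => simpa [hg_def, force_zero] using mul_nonneg (by positivity) hf
    | succ m => simp [hg_def, force_succ]
  have hgs : Summable fun n => g (n + 1) ^ 2 := by
    refine summable_of_ne_finset_zero (s := {0}) fun n hn => ?_
    rw [Finset.mem_singleton] at hn
    obtain ⟨m, rfl⟩ := Nat.exists_eq_succ_of_ne_zero hn
    simp [hg_def, force_succ]
  have hu0 : dyadicNormSq ((2 : ℝ) ^ c) (1 / c) u0 < ⊤ := by
    rw [hu0_def, dyadicNormSq_shift hc.ne' a₀]
    exact ENNReal.mul_lt_top ENNReal.ofReal_lt_top ha₀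
  obtain ⟨u, hu, -⟩ :=
    Cheskidov2008_thm44_holds ((2 : ℝ) ^ c) (ν / 4) (1 / c) hL (by positivity) hα g hg hgs u0 hu0
  refine ⟨fun j t => ((2 : ℝ) ^ c) ^ 2 * u (j + 1) t,
    IsSolution.of_isCheskidovSolution hc.ne' hu (fun n => rfl), fun j => ?_⟩
  obtain ⟨-, hinit, -, -⟩ := hu
  simp only [hinit (j + 1) (by omega), hu0_def]
  field_simp

/-- **The hypothesis class of Thms. 3.4/4.2 is inhabited** (for `0 < c ≤ 2`): given `f₀ ≥ 0` and
a non-negative datum of finite `H¹` norm, there is, for every viscosity `ν > 0`, a solution of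
(1.2) from that datum — a vanishing-viscosity family of the kind the named facts
`CheskidovFriedlander2009_globalAttractor`/`_thm42` quantify over. [cite: CheskidovFriedlander2009, Thm 3.2 p.7] -/
theorem exists_solutionFamily {c f₀ : ℝ} (hc : 0 < c) (hc2 : c ≤ 2) (hf : 0 ≤ f₀) {a₀ : ℕ → ℝ}
    (ha₀ : h1NormSq a₀ < ⊤) (hpos : ∀ j, 0 ≤ a₀ j) :
    ∃ a : ℝ → ℕ → ℝ → ℝ, ∀ ν, 0 < ν →
      IsSolution c ν (force f₀) (a ν) ∧ (∀ j, a ν j 0 = a₀ j) ∧ ∀ j, 0 ≤ a ν j 0 := by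
  have h : ∀ ν : ℝ, ∃ a : ℕ → ℝ → ℝ, 0 < ν → IsSolution c ν (force f₀) a ∧ ∀ j, a j 0 = a₀ j := by
    intro ν
    by_cases hν : 0 < ν
    · obtain ⟨a, ha, h0⟩ := exists_isSolution hc hc2 hν hf ha₀
      exact ⟨a, fun _ => ⟨ha, h0⟩⟩
    · exact ⟨fun _ _ => 0, fun h => absurd h hν⟩
  choose a ha using h
  refine ⟨a, fun ν hν => ⟨(ha ν hν).1, (ha ν hν).2, fun j => ?_⟩⟩
  rw [(ha ν hν).2 j]
  exact hpos j

/-- **Zeroth-law shape for the dyadic model, modulo the named fact Thm. 4.2** (`3/2 < c ≤ 2`,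
`f₀ > 0`): from any non-negative `H¹` datum the solutions `a^ν` (one for each `ν > 0`, from
`exists_solutionFamily`) have long-time mean dissipation eventually above any `ε < ε_d`,
uniformly in `0 < ν < ν₀`. [cite: CheskidovFriedlander2009, Thm 4.2 p.9] -/
theorem CheskidovFriedlander2009_thm42.exists_floor (h : CheskidovFriedlander2009_thm42)
    {c f₀ : ℝ} (hc : 3 / 2 < c) (hc2 : c ≤ 2) (hf : 0 < f₀) {a₀ : ℕ → ℝ}
    (ha₀ : h1NormSq a₀ < ⊤) (hpos : ∀ j, 0 ≤ a₀ j) {ε : ℝ} (hε : ε < epsilonD c f₀) :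
    ∃ a : ℝ → ℕ → ℝ → ℝ, (∀ ν, 0 < ν → IsSolution c ν (force f₀) (a ν) ∧ ∀ j, a ν j 0 = a₀ j) ∧
      ∃ ν₀ : ℝ, 0 < ν₀ ∧ ∀ ν, 0 < ν → ν < ν₀ → ∀ᶠ T in atTop, ε < meanDissipation ν (a ν) T := by
  obtain ⟨a, ha⟩ := exists_solutionFamily (by linarith) hc2 hf.le ha₀ hpos
  refine ⟨a, fun ν hν => ⟨(ha ν hν).1, (ha ν hν).2.1⟩, ?_⟩
  exact h.floor hc (by linarith) hf (fun ν hν => ⟨(ha ν hν).1, (ha ν hν).2.2⟩) hε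

end Literature.Analysis.FluidPDE.CheskidovFriedlander2009

end
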